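import Summits.BirchSwinnertonDyer.BirchSwinnertonDyer.Theorems.RamifiedHeegnerPairLeafRankOneUpperAtThreeOptimalManin
import Summits.BirchSwinnertonDyer.BirchSwinnertonDyer.Theorems.RamifiedHeegnerPairLeafOffHabitatAtlas
import Literature.NumberTheory.EllipticCurves.QuadraticTwistPadicReduction
import Literature.NumberTheory.EllipticCurves.MatsunoTwistedCurvesLocalProofs
import Literature.NumberTheory.EllipticCurves.BSDSelmerSkinnerThmBProofs
import Literature.NumberTheory.EllipticCurves.LeadingTermBSZOrdinaryProofs
import HarnessLib

/-!
# Route `RamifiedHeegnerPair`, cruxes U₁ `LeafRankOneUpperAtThree` (26022) ∕ U₀ `LeafRankZeroUpperAtThree` (26024), line `partnerdescent` —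
# the `3`-GOOD TWIST PARTNER of a leaf curve: good reduction at `3`, and the local data at the primes `ℓ ≡ 1 (mod 3)` of the inert set
# (part 4a of the partner kernel, shared by the rank-one and rank-zero roads)

HONEST FRAMING. Theorems only; helper file (`--supports stmt-BirchSwinnertonDyer-26022 --as helper`); no definition, no named
fact, no `sorry`; nothing booked, no item closed; unconditional elementary facts (Tate ∕ Kodaira–Néron ∕ Hensel), BSD is proved
for no curve. Lead prover bsd-line-rhp-p2 g55, 2026-08-30.

* `hasGoodReductionAtPrime_three_of_smul_eq_quadraticTwist_negThree` — on the leaf (`Addv W 3`, `SubGss W 3`: Kodaira `I₀*` at `3`) every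
  `ℚ`-model of the twist `W ⊗ χ₋₃ = W.quadraticTwist (-3)` has GOOD reduction at `3` (`−3` is a `3`-uniformiser; Silverman *ATAEC* IV.11.1).
* `split_and_ordDiscr_eq_of_smul_eq_quadraticTwist_negThree` — at a prime `ℓ ≠ 2` with `(−3/ℓ) = 1` (so `−3 ∈ (ℚ_ℓ^×)²` by Hensel) the
  twist is `ℚ_ℓ`-isomorphic to `W`: split multiplicative reduction transports and `ord_ℓ Δ_min` agrees (both equal `c_ℓ`, Kodaira–Néron).

References: [cite: SilvermanATAEC1994, IV.11.1 table p. 368 (I₀*), Cor. IV.9.2(d)] [cite: SilvermanAEC2009, X.5 Cor. 5.4, VII.5 Prop. 5.1]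
[cite: Matsuno2009, proof of Cor. 6.2 (p. 460)] [cite: Serre1973, Ch. II §3.3 Thm 3] [cite: Stevens1989, Lemmas (5.2), (5.4)]. presearch: «twist
by −3 of an I₀* fibre at 3 is good» → tree theorem `hasGoodReductionAt_quadraticTwist_of_kodairaSymbolAt_eq_Istar_zero` (Ogg ∕ Silverman IV.11.1);
«(−3/ℓ)=1 ⇒ square twist, same reduction» → tree `hasSplitMultiplicativeReductionAtPrime_quadraticTwist_iff` (Matsuno Cor. 6.2); corpus+galaxy n/a.
-/

-- D-0017: single-problem summit, so `Summit.BirchSwinnertonDyer.BirchSwinnertonDyer.…` repeats a namespace BY DESIGN.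
set_option linter.dupNamespace false
set_option autoImplicit false

noncomputable section

open scoped Classical NumberField

open WeierstrassCurve NumberField IsDedekindDomain Literature Literature.NumberTheory.EllipticCurves
  Rat.HeightOneSpectrum CongruenceSubgroup
  Literature.NumberTheory.EllipticCurves.ModularForms
  Literature.NumberTheory.EllipticCurves.Rank1Residual
  Literature.NumberTheory.EllipticCurves.Rank1Residual.Typed
  Literature.NumberTheory.QuadraticFields.Quadratic
  Literature.NumberTheory.GaloisCohomology
  Literature.NumberTheory.Automorphic
  Summit.BirchSwinnertonDyer.Rank1Residual
  Summit.BirchSwinnertonDyer.Rank1Residual.Additive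
  Summit.BirchSwinnertonDyer.Rank1Residual.X11b
  Summit.BirchSwinnertonDyer.Rank1Residual.X11b.Three
  Summit.BirchSwinnertonDyer.BirchSwinnertonDyer.Theses.RamifiedHeegnerPair
  Summit.BirchSwinnertonDyer.BirchSwinnertonDyer.Theorems
  Summit.BirchSwinnertonDyer.BirchSwinnertonDyer.Theorems.RamifiedPairUpperBound

namespace Summit.BirchSwinnertonDyer.BirchSwinnertonDyer.Theorems.LeafShimuraInert

/-! ## §1 The `3`-good twist partner of a leaf curve -/

/-- **The twist `W ⊗ χ₋₃` of a leaf curve is GOOD at `3`.** On the leaf (`Addv W 3`, `SubGss W 3`) the fibre at `3` is Kodaira `I₀*`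
(`kodairaSymbolAt_three_eq_Istar_zero_of_subGss`); `−3 = 3*` is a `3`-uniformiser, so the quadratic twist by it has good reduction at
`3` (Silverman *ATAEC* IV.11.1, table p. 368: the tree theorem `hasGoodReductionAt_quadraticTwist_of_kodairaSymbolAt_eq_Istar_zero`),
and so has every `ℚ`-model of it. [cite: SilvermanATAEC1994, IV.11.1 table p. 368 (column I₀*)] [cite: SilvermanAEC2009, VII.5 Prop. 5.1(a)] -/
theorem hasGoodReductionAtPrime_three_of_smul_eq_quadraticTwist_negThree
    (W : WeierstrassCurve ℚ) [W.IsElliptic] [W.IsGloballyMinimal] (hadd : Addv W 3) (hsub : SubGss W 3)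
    {V : WeierstrassCurve ℚ} (CV : VariableChange ℚ) (hV : CV • W.quadraticTwist (-3) = V) :
    V.HasGoodReductionAtPrime 3 := by
  haveI h3F : Fact (Nat.Prime 3) := ⟨Nat.prime_three⟩
  have hp : (3 : ℕ).Prime := Nat.prime_three
  have hK : W.kodairaSymbolAt (Additive.placeOf 3) = .Istar 0 := kodairaSymbolAt_three_eq_Istar_zero_of_subGss W hadd hsub
  have hgen : natGenerator (Additive.placeOf 3) = 3 :=
    Literature.NumberTheory.EllipticCurves.natGenerator_primesEquiv_symm hp
  have h2 : ringChar (ℤ ⧸ (Additive.placeOf 3).asIdeal) ≠ 2 := by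
    rw [Literature.NumberTheory.EllipticCurves.Rat.ringChar_int_quotient_asIdeal, hgen]; decide
  have h3v : (Additive.placeOf 3).valuation ℚ ((natGenerator (Additive.placeOf 3) : ℕ) : ℚ) = WithZero.exp (-1 : ℤ) :=
    valuation_natGenerator_int (Additive.placeOf 3)
  have hπ : (Additive.placeOf 3).valuation ℚ (-3 : ℚ) = WithZero.exp (-1 : ℤ) := by
    rw [hgen] at h3v
    rw [show (-3 : ℚ) = -((3 : ℕ) : ℚ) by norm_num, Valuation.map_neg, h3v]
  have hgood : (W.quadraticTwist (-3 : ℚ)).HasGoodReductionAt (Additive.placeOf 3) :=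
    W.hasGoodReductionAt_quadraticTwist_of_kodairaSymbolAt_eq_Istar_zero (Additive.placeOf 3) h2 hK hπ
  have hgood' : (W.quadraticTwist (-3 : ℚ)).HasGoodReductionAtPrime 3 := by
    have := (hasGoodReductionAtPrime_primesEquiv_iff_hasGoodReductionAt (W.quadraticTwist (-3 : ℚ)) (Additive.placeOf 3)).mpr
      hgood
    have hval : (primesEquiv (R := ℤ) (Additive.placeOf 3) : ℕ) = 3 := Additive.primesEquiv_placeOf_val 3
    revert this
    generalize hP : primesEquiv (R := ℤ) (Additive.placeOf 3) = P
    obtain ⟨P, hPp⟩ := P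
    intro h
    have hP3 : P = 3 := by rw [hP] at hval; exact hval
    subst hP3
    exact h
  rw [← hV]
  exact (Literature.NumberTheory.EllipticCurves.BSZLemma17.hasGoodReductionAtPrime_smul_iff _ CV 3).mpr hgood'

/-- **At a prime `ℓ ≠ 2` with `(−3/ℓ) = 1` the twist `W ⊗ χ₋₃` is `ℚ_ℓ`-isomorphic to `W`**: so if `W` is split multiplicative at `ℓ`, every
`ℚ`-model `V` of the twist is split multiplicative at `ℓ` with the same local Tamagawa number and the same `ord_ℓ Δ_min` (Kodaira–Néron
`c_ℓ = ord_ℓ Δ_min` on both sides). [cite: Matsuno2009, proof of Cor. 6.2 (p. 460)] [cite: SilvermanATAEC1994, Cor. IV.9.2(d)]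
[cite: Serre1973, Ch. II §3.3 Thm 3] -/
theorem split_and_ordDiscr_eq_of_smul_eq_quadraticTwist_negThree
    (W : WeierstrassCurve ℚ) [W.IsElliptic] [W.IsGloballyMinimal] {V : WeierstrassCurve ℚ} [V.IsElliptic] [V.IsGloballyMinimal]
    (CV : VariableChange ℚ) (hV : CV • W.quadraticTwist (-3) = V)
    (ℓ : ℕ) [Fact ℓ.Prime] (hℓ2 : ℓ ≠ 2) (hJ : jacobiSym (-3) ℓ = 1) (hs : W.HasSplitMultiplicativeReductionAtPrime ℓ) :
    V.HasSplitMultiplicativeReductionAtPrime ℓ ∧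
      padicValInt ℓ V.minimalDiscriminantInt = padicValInt ℓ W.minimalDiscriminantInt := by
  have hd : (-3 : ℚ) ≠ 0 := by norm_num
  haveI hEt : (W.quadraticTwist (-3 : ℚ)).IsElliptic := W.isElliptic_quadraticTwist hd
  -- `−3` is a square in `ℚ_ℓ`
  have hsqZ : IsSquare (((-3 : ℤ) : ℤ) : ℚ_[ℓ]) := padic_isSquare_of_jacobiSym_eq_one hℓ2 hJ
  have hsq : IsSquare (algebraMap ℚ ℚ_[ℓ] (-3 : ℚ)) := by
    have : algebraMap ℚ ℚ_[ℓ] (-3 : ℚ) = (((-3 : ℤ) : ℤ) : ℚ_[ℓ]) := by push_cast; simp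
    rw [this]; exact hsqZ
  -- split multiplicative reduction transports
  have hsV : V.HasSplitMultiplicativeReductionAtPrime ℓ := by
    rw [← hV, hasSplitMultiplicativeReductionAtPrime_smul_iff]
    exact (W.hasSplitMultiplicativeReductionAtPrime_quadraticTwist_iff hd hsq).mpr hs
  refine ⟨hsV, ?_⟩
  -- the local Tamagawa numbers agree (`V ⊗ ℚ_ℓ ≅ W ⊗ ℚ_ℓ`)
  haveI : (W.baseChange ℚ_[ℓ]).IsElliptic := inferInstanceAs (W.map (algebraMap ℚ ℚ_[ℓ])).IsElliptic
  obtain ⟨θ, hθ⟩ := hsq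
  have hθ0 : θ ≠ 0 := by
    rintro rfl
    exact (map_ne_zero (algebraMap ℚ ℚ_[ℓ])).mpr hd (hθ.trans (mul_zero 0))
  obtain ⟨C, hC⟩ := (W.baseChange ℚ_[ℓ]).exists_variableChange_smul_eq_quadraticTwist_sq hθ0
  have h1 : (W.quadraticTwist (-3 : ℚ)).baseChange ℚ_[ℓ] = C • W.baseChange ℚ_[ℓ] := by
    rw [hC, baseChange, baseChange, map_quadraticTwist, hθ, sq]
  have hYX : V.baseChange ℚ_[ℓ] = (CV.map (algebraMap ℚ ℚ_[ℓ]) * C) • W.baseChange ℚ_[ℓ] := by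
    rw [← hV, WeierstrassCurve.VariableChange.baseChange_smul_eq (W.quadraticTwist (-3 : ℚ)) CV ℚ_[ℓ], h1, mul_smul]
  have hc : (V.baseChange ℚ_[ℓ]).localTamagawaNumber ℤ_[ℓ] = (W.baseChange ℚ_[ℓ]).localTamagawaNumber ℤ_[ℓ] := by
    rw [hYX, localTamagawaNumber_variableChange_holds ℤ_[ℓ] (W.baseChange ℚ_[ℓ]) (CV.map (algebraMap ℚ ℚ_[ℓ]) * C)]
  -- Kodaira–Néron on both sides
  rw [← X11b.localTamagawaNumber_eq_padicValInt_of_split V (Additive.placeOf ℓ) (Additive.primesEquiv_placeOf_val ℓ) hsV,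
    ← X11b.localTamagawaNumber_eq_padicValInt_of_split W (Additive.placeOf ℓ) (Additive.primesEquiv_placeOf_val ℓ) hs, hc]

end Summit.BirchSwinnertonDyer.BirchSwinnertonDyer.Theorems.LeafShimuraInert

end
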